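import Literature.NumberTheory.Automorphic.UnitaryRankOneBorelModulusIndex
import HarnessLib

/-!
# The hyperspecial Hecke neighbours of the unramified `U(3)`: a CONTRACTING transversal of `K₀ t K₀ ∕ K₀`,
# `t = diag(ϖ, 1, ϖ⁻¹)`, `K₀ = U(σ, J₀) ∩ GL₃(𝒪)` (Bruhat–Tits 1972 (4.4.3)–(4.4.4); Tits 1979 §3.3.3; Rogawski 1990 §1.10)

Topic `NumberTheory/Automorphic`; namespace `Literature.NumberTheory.Automorphic.HermitianLattice.UnramifiedLocalConjDatum` (the ★ hyperspecial
Satake kit's).  KERNEL MATHEMATICS: two small definitions with bodies (`torusGen`, `heisMid`) + theorems; no named fact, no instance, no notation,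
no `sorry`.  Cell `hodgecm-mathlib`, F0∕P3, fan-B row #90 (SqNS) ∕ #79 (XP) pay-down, road (B) «local», brick **(L1)** (B-p08 (g20) census
10:38:55Z; F0P3-plan (g7) «=» 2026-08-31T19:48:39Z): the GROUP-THEORETIC INPUT of ★ `SphericalCoefficient.not_isSquareIntegrableModCenter_of_isSpherical_of_contracting`
(L2-gen, p832624) for `(G, K, K_N, t) = (U(σ, J₀)(K), K₀, K_P, diag(ϖ, 1, ϖ⁻¹))`, `N = 3`, over the abstract datum ★ `UnramifiedLocalConjDatum σ ϖ`
(`K` a valued field, `σ` an involution preserving `v`, `σ`-fixed uniformiser `ϖ`, (trace), (norm) — EVERY residue characteristic, no finiteness).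

## The mathematics

`G = U(σ, J₀)(K)`, `J₀ = antidiag(1,1,1)`; `K₀ = unitaryInt` (hyperspecial); `K_P = hd.borelLatticeU ⊓ K₀ = N(𝒪)` the integral upper
unitriangular elements (★ `UnitaryRankOneBorelModulusIndex.mem_borelInt_iff_three`: `u(α, β) ∈ K_P ↔ v α ≤ 1 ∧ v β ≤ 1`);
`t = diag(ϖ, 1, ϖ⁻¹)` (`torusGen`); `u(0, y) = 1 + y E₀₂` for `y ∈ K⁰ = ker(id + σ)` (`heisMid`).  Then:
* §2 `t K_P t⁻¹ ≤ K_P` (★ `conjAct_smul_inf_le_of_antitone_unitary` at the dominant `(1,0,-1)`);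
* §3 the Cartan shells `K₀ tᵐ K₀` (`m ∈ ℕ`) are pairwise disjoint (★ `eq_of_unitaryInt_mul_zpowDiagGL_mul_eq_of_antitone`) and `t⁻¹ ∈ K₀ t K₀`
  (★ `inv_mem_doubleCoset_unitaryInt`);
* §4 every entry of every `g ∈ K₀ t K₀` has valuation `≤ v(ϖ⁻¹)`;
* §6 **EXHAUSTION** (`exists_rep_of_mem_doubleCoset_torusGen`): every `g K₀ ⊆ K₀ t K₀` is `u t K₀` with `u ∈ K_P`, or `u(0, y) K₀` with `v(y) = v(ϖ⁻¹)`,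
  or `t⁻¹ K₀` — by the Iwasawa normal form `g = u · diag(ϖ^a) · k` (★ `exists_eq_unipotent_mul_zpowDiagGL_mul_unitaryInt`), the §4 bound
  (`a₀ ∈ {1, 0, -1}`), the unitarity relations `u₁₂ = -σ(u₀₁)`, `u₀₂ + σ(u₀₂) = -u₀₁ σ(u₀₁)` (★ `apply_one_two_eq_three`,
  `apply_add_map_apply_eq_three`) and the (trace) element `τ` (`τ + στ = 1`, no `½`);
* §7 the cells are told apart by their Iwasawa exponents `(1,0,-1)`, `0`, `(-1,0,1)` (★ `iwasawaExp_eq`, `iwasawaExp_eq_of_coe_eq`);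
  `u t K₀ = u' t K₀ ↔ u⁻¹u' ∈ t K_P t⁻¹` and `u(0,y) K₀ = u(0,y') K₀ ↔ v(y' - y) ≤ 1`; `u(0, y) ∈ K₀ t K₀` for `v(y) = v(ϖ⁻¹)`;
* §8 **`bijOn_heckeNeighbours`**: for EVERY transversal `R₊ ⊆ K_P` of `K_P ∕ t K_P t⁻¹` and every transversal `R₀ ⊆ K⁰` of the classes of
  valuation `v(ϖ⁻¹)` modulo `𝒪⁰`, the finite set `X = R₊·t ∪ u(0, R₀) ∪ {t⁻¹}` maps bijectively onto `K₀ t K₀ ∕ K₀` — the hypothesis `hX` of L2-gen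
  in CONTRACTING FORM (`x t⁻¹ ∈ K_P` on `R₊ t`, `t x t⁻¹ ∈ K_P` on `u(0, R₀)` by `conj_torusGen_heisMid_mem_borelInt`).
This is [BruhatTits1972 (4.4.4)] for the hyperspecial vertex of the semi-homogeneous tree of `U(3)`: `K₀ t K₀ ∕ K₀` has
`[K_P : tK_Pt⁻¹] + ([L_1 : L_0] - 1) + 1 = q⁴ + (q - 1) + 1` points (`q = q_F`; the COUNTS are ★ `relIndex_conjAct_borelInt_eq_pow_three` and ★
`UnramifiedTraceZeroLatticeIndex`, assembled in the sequel (L1b)); the three cells are the neighbours at Busemann levels `+1, 0, -1`.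
HC_CM is proved only modulo the printed citations until rung 0 closes; this file is unconditional and discharges nothing by itself.

## References
* [BruhatTits1972] F. Bruhat, J. Tits, *Groupes réductifs sur un corps local I*, Publ. Math. IHÉS 41 (1972), (4.4.3), (4.4.4).
* [Tits1979] J. Tits, *Reductive groups over local fields*, PSPM 33.1 (1979), §3.3.3.
* [Rogawski1990] J. D. Rogawski, *Automorphic Representations of Unitary Groups in Three Variables*, Ann. of Math. Stud. 123 (1990), §1.10 p. 14.
* [SerreTrees1980] J.-P. Serre, *Trees* (1980), II.1.1.
* [Serre1979] J.-P. Serre, *Local Fields*, GTM 67 (1979), Ch. I §1.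
* [CartierCorvallis1979] P. Cartier, *Representations of 𝔭-adic groups: a survey*, PSPM 33.1 (1979), §IV (4.2).
-/

set_option autoImplicit false

noncomputable section

open scoped Valued WithZero Matrix MatrixGroups Pointwise
open MulAction ConjAct

namespace Literature.NumberTheory.Automorphic.HermitianLattice

open Literature.NumberTheory.Automorphic.CartanUnique Literature.NumberTheory.Automorphic.SymplecticCartan

variable {K : Type*} [Field K] [Valued K ℤᵐ⁰] {σ : K →+* K} {ϖ : K}

namespace UnramifiedLocalConjDatum

/-! ## §1 The generator `t = diag(ϖ, 1, ϖ⁻¹)` of the dominant ray -/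

/-- The cocharacter `(1, 0, -1)` of the maximal split torus of `U(3)` is anti-symmetric under `rev`. [cite: BruhatTits1972, (4.4.3)] -/
theorem rev_cocharOne (i : Fin 3) : (![1, 0, -1] : Fin 3 → ℤ) (Fin.rev i) = -(![1, 0, -1] : Fin 3 → ℤ) i := by
  fin_cases i <;> rfl

/-- The cocharacter `(1, 0, -1)` is antitone (dominant). [cite: BruhatTits1972, (4.4.3)] -/
theorem antitone_cocharOne : Antitone (![1, 0, -1] : Fin 3 → ℤ) := by
  intro i j hij
  fin_cases i <;> fin_cases j <;> first | decide | exact absurd hij (by decide)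

/-- `(m(1,0,-1))` is antitone for `m ∈ ℕ`. [cite: BruhatTits1972, (4.4.3)] -/
theorem antitone_nsmul_cocharOne (m : ℕ) : Antitone ((m : ℤ) • (![1, 0, -1] : Fin 3 → ℤ)) := fun i j hij => by
  simp only [Pi.smul_apply, smul_eq_mul]
  exact Int.mul_le_mul_of_nonneg_left (antitone_cocharOne hij) (Int.natCast_nonneg m)

/-- `(m(1,0,-1))` is anti-symmetric under `rev`. [cite: BruhatTits1972, (4.4.3)] -/
theorem rev_nsmul_cocharOne (m : ℕ) (i : Fin 3) :
    ((m : ℤ) • (![1, 0, -1] : Fin 3 → ℤ)) (Fin.rev i) = -((m : ℤ) • (![1, 0, -1] : Fin 3 → ℤ)) i := by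
  rw [Pi.smul_apply, Pi.smul_apply, rev_cocharOne, smul_neg]

/-- **`t = diag(ϖ, 1, ϖ⁻¹) ∈ U(σ, J₀)(K)`** (`N = 3`): the generator of the dominant ray of the maximal split torus — the one that
CONTRACTS the integral upper unitriangular subgroup (`t N(𝒪) t⁻¹ ≤ N(𝒪)`); `K₀ tᵐ K₀` (`m ∈ ℕ`) are the Cartan shells.
[cite: BruhatTits1972, (4.4.3)] [cite: Rogawski1990, §1.10 p. 14] -/
def torusGen (hd : UnramifiedLocalConjDatum σ ϖ) : unitaryGroupOfForm σ ((StdForm.antidiagonal 3).over K) :=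
  ⟨zpowDiagGL (uniformizer_ne_zero hd.vϖ) ![1, 0, -1], zpowDiagGL_mem_unitaryGroupOfForm hd.σϖ _ rev_cocharOne⟩

/-- The matrix of `t`: `diag(ϖ, 1, ϖ⁻¹)`. [cite: BruhatTits1972, (4.4.3)] -/
theorem coe_torusGen (hd : UnramifiedLocalConjDatum σ ϖ) :
    ((hd.torusGen : unitaryGroupOfForm σ ((StdForm.antidiagonal 3).over K)) : GL (Fin 3) K) =
      zpowDiagGL (uniformizer_ne_zero hd.vϖ) ![1, 0, -1] := rfl

/-- Powers of `t`: `tᵐ = diag(ϖ^{m(1,0,-1)})`. [cite: BruhatTits1972, (4.4.3)] -/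
theorem coe_torusGen_pow (hd : UnramifiedLocalConjDatum σ ϖ) (m : ℕ) :
    ((hd.torusGen ^ m : unitaryGroupOfForm σ ((StdForm.antidiagonal 3).over K)) : GL (Fin 3) K) =
      zpowDiagGL (uniformizer_ne_zero hd.vϖ) ((m : ℤ) • ![1, 0, -1]) := by
  rw [Subgroup.coe_pow, coe_torusGen]
  induction m with
  | zero => rw [pow_zero, Nat.cast_zero, zero_smul, zpowDiagGL_zero]
  | succ k ih => rw [pow_succ, ih, ← zpowDiagGL_add, Nat.cast_succ, add_smul, one_smul]

/-- `tᵐ` as the normalised torus representative of its Cartan shell. [cite: BruhatTits1972, (4.4.3)] -/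
theorem torusGen_pow_eq (hd : UnramifiedLocalConjDatum σ ϖ) (m : ℕ) :
    hd.torusGen ^ m = ⟨zpowDiagGL (uniformizer_ne_zero hd.vϖ) ((m : ℤ) • ![1, 0, -1]),
      zpowDiagGL_mem_unitaryGroupOfForm hd.σϖ _ (rev_nsmul_cocharOne m)⟩ :=
  Subtype.ext (hd.coe_torusGen_pow m)

/-- The matrix of `t⁻¹`: `diag(ϖ⁻¹, 1, ϖ)`. [cite: BruhatTits1972, (4.4.3)] -/
theorem coe_torusGen_inv (hd : UnramifiedLocalConjDatum σ ϖ) :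
    ((hd.torusGen⁻¹ : unitaryGroupOfForm σ ((StdForm.antidiagonal 3).over K)) : GL (Fin 3) K) =
      zpowDiagGL (uniformizer_ne_zero hd.vϖ) (-![1, 0, -1]) := by
  rw [Subgroup.coe_inv, coe_torusGen, zpowDiagGL_neg]

/-! ## §2 `t` contracts `K_P = N(𝒪)` -/

omit [Valued K ℤᵐ⁰] in
/-- Conjugation by a diagonal matrix scales entries: `(diag(ϖ^a) g diag(ϖ^a)⁻¹)_{ij} = ϖ^{a_i - a_j} g_{ij}`. [cite: BruhatTits1972, (4.4.4)] -/
theorem coe_zpowDiagGL_conj_apply' {hϖ0 : ϖ ≠ 0} (a : Fin 3 → ℤ) (g : GL (Fin 3) K) (i j : Fin 3) :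
    ((zpowDiagGL hϖ0 a * g * (zpowDiagGL hϖ0 a)⁻¹ : GL (Fin 3) K) : Matrix (Fin 3) (Fin 3) K) i j =
      ϖ ^ (a i - a j) * (g : Matrix (Fin 3) (Fin 3) K) i j := by
  rw [← zpowDiagGL_neg, Units.val_mul, Units.val_mul, coe_zpowDiagGL, coe_zpowDiagGL, Matrix.mul_diagonal, Matrix.diagonal_mul,
    Pi.neg_apply, zpow_sub₀ hϖ0, zpow_neg, div_eq_mul_inv]
  ring

/-- Entries of `t g t⁻¹`: `ϖ^{ℓ_i - ℓ_j} g_{ij}`, `ℓ = (1, 0, -1)`. [cite: BruhatTits1972, (4.4.4)] -/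
theorem coe_conj_torusGen_apply (hd : UnramifiedLocalConjDatum σ ϖ) (g : unitaryGroupOfForm σ ((StdForm.antidiagonal 3).over K)) (i j : Fin 3) :
    (((hd.torusGen * g * hd.torusGen⁻¹ : unitaryGroupOfForm σ ((StdForm.antidiagonal 3).over K)) : GL (Fin 3) K) : Matrix (Fin 3) (Fin 3) K) i j =
      ϖ ^ ((![1, 0, -1] : Fin 3 → ℤ) i - (![1, 0, -1] : Fin 3 → ℤ) j) * ((g : GL (Fin 3) K) : Matrix (Fin 3) (Fin 3) K) i j := by
  rw [Subgroup.coe_mul, Subgroup.coe_mul, Subgroup.coe_inv, coe_torusGen, coe_zpowDiagGL_conj_apply']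

/-- **`t K_P t⁻¹ ≤ K_P`** (`K_P = P ∩ K₀ = N(𝒪)`, ★ `conjAct_smul_inf_le_of_antitone_unitary` at the dominant `(1,0,-1)`): `t u t⁻¹ ∈ K_P` for `u ∈ K_P`.
[cite: BruhatTits1972, (4.4.4)] [cite: CartierCorvallis1979, §IV (4.2)] -/
theorem conj_torusGen_mem_borelInt (hd : UnramifiedLocalConjDatum σ ϖ) {u : unitaryGroupOfForm σ ((StdForm.antidiagonal 3).over K)}
    (hu : u ∈ hd.borelLatticeU ⊓ unitaryInt σ ((StdForm.antidiagonal 3).over K)) :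
    hd.torusGen * u * hd.torusGen⁻¹ ∈ hd.borelLatticeU ⊓ unitaryInt σ ((StdForm.antidiagonal 3).over K) := by
  have h := hd.conjAct_smul_inf_le_of_antitone_unitary antitone_cocharOne rev_cocharOne
  rw [← toConjAct_smul]
  exact h (Subgroup.smul_mem_pointwise_smul _ _ _ hu)

/-! ## §3 The Cartan shells `K₀ tᵐ K₀` are pairwise disjoint; `t⁻¹ ∈ K₀ t K₀` -/

/-- **The shells `K₀ tᵐ K₀` (`m ∈ ℕ`) are pairwise disjoint** (uniqueness of the antitone Cartan exponents, ★
`eq_of_unitaryInt_mul_zpowDiagGL_mul_eq_of_antitone`, at the exponents `m·(1,0,-1)`). [cite: BruhatTits1972, (4.4.3)] [cite: Tits1979, §3.3.3] -/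
theorem disjoint_doubleCoset_torusGen_pow (hd : UnramifiedLocalConjDatum σ ϖ) {m n : ℕ} (hmn : m ≠ n) :
    Disjoint (DoubleCoset.doubleCoset (hd.torusGen ^ m) (unitaryInt σ ((StdForm.antidiagonal 3).over K) : Set _)
        (unitaryInt σ ((StdForm.antidiagonal 3).over K)))
      (DoubleCoset.doubleCoset (hd.torusGen ^ n) (unitaryInt σ ((StdForm.antidiagonal 3).over K) : Set _)
        (unitaryInt σ ((StdForm.antidiagonal 3).over K))) := by
  by_contra h
  have hmem := DoubleCoset.mem_doubleCoset_of_not_disjoint h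
  obtain ⟨k₁, hk₁, k₂, hk₂, heq⟩ := DoubleCoset.mem_doubleCoset.1 hmem
  rw [hd.torusGen_pow_eq m, hd.torusGen_pow_eq n] at heq
  have hab := eq_of_unitaryInt_mul_zpowDiagGL_mul_eq_of_antitone hd.vϖ hd.σϖ ⟨antitone_nsmul_cocharOne m, rev_nsmul_cocharOne m⟩
    ⟨antitone_nsmul_cocharOne n, rev_nsmul_cocharOne n⟩ hk₁ hk₂ heq.symm
  have h0 := congrFun hab 0
  simp only [Pi.smul_apply, Matrix.cons_val_zero, smul_eq_mul, mul_one, Nat.cast_inj] at h0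
  exact hmn h0

/-- **`t⁻¹ ∈ K₀ t K₀`** (the Weyl element `J₀ ∈ K₀` inverts `t`; ★ `inv_mem_doubleCoset_unitaryInt`). [cite: BruhatTits1972, (4.4.3)] -/
theorem inv_torusGen_mem_doubleCoset (hd : UnramifiedLocalConjDatum σ ϖ) :
    hd.torusGen⁻¹ ∈ DoubleCoset.doubleCoset hd.torusGen (unitaryInt σ ((StdForm.antidiagonal 3).over K) : Set _)
      (unitaryInt σ ((StdForm.antidiagonal 3).over K)) :=
  inv_mem_doubleCoset_unitaryInt hd hd.torusGen

/-! ## §4 Entries on the shell `K₀ t K₀` have valuation `≤ v(ϖ⁻¹)` -/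

/-- **Every entry of `g ∈ K₀ t K₀` has valuation `≤ exp 1 = v(ϖ⁻¹)`** (`g = k₁ t k₂` with `k₁, k₂` integral and `t = diag(ϖ, 1, ϖ⁻¹)`;
ultrametric inequality). [cite: BruhatTits1972, (4.4.3)] -/
theorem v_apply_le_exp_one_of_mem_doubleCoset_torusGen (hd : UnramifiedLocalConjDatum σ ϖ)
    {g : unitaryGroupOfForm σ ((StdForm.antidiagonal 3).over K)}
    (hg : g ∈ DoubleCoset.doubleCoset hd.torusGen (unitaryInt σ ((StdForm.antidiagonal 3).over K) : Set _)
      (unitaryInt σ ((StdForm.antidiagonal 3).over K))) (i j : Fin 3) :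
    Valued.v (((g : GL (Fin 3) K) : Matrix (Fin 3) (Fin 3) K) i j) ≤ WithZero.exp (1 : ℤ) := by
  obtain ⟨k₁, hk₁, k₂, hk₂, rfl⟩ := DoubleCoset.mem_doubleCoset.1 hg
  have h1 := (mem_unitaryInt_iff.1 (hk₁ : k₁ ∈ unitaryInt σ _)).1
  have h2 := (mem_unitaryInt_iff.1 (hk₂ : k₂ ∈ unitaryInt σ _)).1
  rw [Subgroup.coe_mul, Subgroup.coe_mul, Units.val_mul, Units.val_mul, Matrix.mul_apply]
  refine Valuation.map_sum_le _ fun l _ => ?_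
  rw [Matrix.mul_apply, Finset.sum_mul]
  refine Valuation.map_sum_le _ fun m _ => ?_
  rw [map_mul, map_mul, coe_torusGen, coe_zpowDiagGL, Matrix.diagonal_apply]
  split_ifs with hml
  · rw [v_uniformizer_zpow hd.vϖ]
    have hle : WithZero.exp (-(![1, 0, -1] : Fin 3 → ℤ) m) ≤ WithZero.exp (1 : ℤ) := by
      rw [WithZero.exp_le_exp]; fin_cases m <;> simp
    calc Valued.v (((k₁ : GL (Fin 3) K) : Matrix (Fin 3) (Fin 3) K) i m) * WithZero.exp (-(![1, 0, -1] : Fin 3 → ℤ) m) *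
          Valued.v (((k₂ : GL (Fin 3) K) : Matrix (Fin 3) (Fin 3) K) l j)
        ≤ 1 * WithZero.exp (1 : ℤ) * 1 := mul_le_mul' (mul_le_mul' (h1 i m) hle) (hml ▸ h2 m j)
      _ = WithZero.exp (1 : ℤ) := by rw [one_mul, mul_one]
  · rw [map_zero, mul_zero, zero_mul]; exact zero_le

/-- `g k⁻¹ ∈ K₀ t K₀` for `g ∈ K₀ t K₀`, `k ∈ K₀`. [cite: BruhatTits1972, (4.4.3)] -/
theorem mul_inv_mem_doubleCoset_torusGen (hd : UnramifiedLocalConjDatum σ ϖ) {g k : unitaryGroupOfForm σ ((StdForm.antidiagonal 3).over K)}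
    (hg : g ∈ DoubleCoset.doubleCoset hd.torusGen (unitaryInt σ ((StdForm.antidiagonal 3).over K) : Set _)
      (unitaryInt σ ((StdForm.antidiagonal 3).over K))) (hk : k ∈ unitaryInt σ ((StdForm.antidiagonal 3).over K)) :
    g * k⁻¹ ∈ DoubleCoset.doubleCoset hd.torusGen (unitaryInt σ ((StdForm.antidiagonal 3).over K) : Set _)
      (unitaryInt σ ((StdForm.antidiagonal 3).over K)) := by
  obtain ⟨k₁, hk₁, k₂, hk₂, rfl⟩ := DoubleCoset.mem_doubleCoset.1 hg
  exact DoubleCoset.mem_doubleCoset.2 ⟨k₁, hk₁, k₂ * k⁻¹, (unitaryInt σ _).mul_mem hk₂ ((unitaryInt σ _).inv_mem hk), by rw [mul_assoc]⟩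

/-! ## §5 The level-zero neighbours `u(0, y) = 1 + y E₀₂`, `y + σ y = 0` -/

omit [Valued K ℤᵐ⁰] in
/-- Entries of the transvection `1 + y E₀₂`. [cite: Rogawski1990, §1.10 p. 14] -/
theorem transvection_zero_two_apply (y : K) (i j : Fin 3) :
    Matrix.transvection (0 : Fin 3) 2 y i j = (if i = j then 1 else 0) + (if 0 = i ∧ 2 = j then y else 0) := by
  simp [Matrix.transvection, Matrix.one_apply, Matrix.single, Matrix.of_apply]

omit [Valued K ℤᵐ⁰] in
/-- The transvection `1 + y E₀₂` with `y + σ y = 0` is unitary for `J₀ = antidiag(1,1,1)` (Rogawski's `u(0, z)`, `z + z̄ = 0`).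
[cite: Rogawski1990, §1.10 p. 14] -/
theorem transvection_mem_unitaryGroupOfForm (σ : K →+* K) (y : (AddMonoidHom.id K + σ.toAddMonoidHom).ker) :
    (⟨Matrix.transvection 0 2 (y : K), Matrix.transvection 0 2 (-(y : K)),
        by rw [Matrix.transvection_mul_transvection_same (0 : Fin 3) 2 (by decide), add_neg_cancel, Matrix.transvection_zero],
        by rw [Matrix.transvection_mul_transvection_same (0 : Fin 3) 2 (by decide), neg_add_cancel, Matrix.transvection_zero]⟩ :
        GL (Fin 3) K) ∈ unitaryGroupOfForm σ ((StdForm.antidiagonal 3).over K) := by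
  have hy : σ (y : K) = -(y : K) := by
    have h := (mem_ker_id_add_iff (σ := σ) (y : K)).1 y.2
    linear_combination h
  rw [mem_unitaryGroupOfForm_antidiagonal_iff_sum (σ := σ)]
  intro a b
  have r0 : (0 : Fin 3).rev = 2 := rfl; have r1 : (1 : Fin 3).rev = 1 := rfl; have r2 : (2 : Fin 3).rev = 0 := rfl
  simp only [Fin.sum_univ_three, r0, r1, r2]
  change σ (Matrix.transvection (0 : Fin 3) 2 (y : K) 0 a) * Matrix.transvection (0 : Fin 3) 2 (y : K) 2 b +
    σ (Matrix.transvection (0 : Fin 3) 2 (y : K) 1 a) * Matrix.transvection (0 : Fin 3) 2 (y : K) 1 b +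
    σ (Matrix.transvection (0 : Fin 3) 2 (y : K) 2 a) * Matrix.transvection (0 : Fin 3) 2 (y : K) 0 b = _
  simp only [transvection_zero_two_apply]
  fin_cases a <;> fin_cases b <;> simp [hy]

/-- **The level-zero neighbour `u(0, y) = 1 + y E₀₂ ∈ U(σ, J₀)(K)`** for `y ∈ K⁰ = ker(id + σ)` (the centre `{u(0, z) : z + z̄ = 0}` of the
Heisenberg group `N`). [cite: Rogawski1990, §1.10 p. 14] [cite: BruhatTits1972, (4.4.4)] -/
def heisMid (σ : K →+* K) (y : (AddMonoidHom.id K + σ.toAddMonoidHom).ker) : unitaryGroupOfForm σ ((StdForm.antidiagonal 3).over K) :=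
  ⟨_, transvection_mem_unitaryGroupOfForm σ y⟩

omit [Valued K ℤᵐ⁰] in
/-- The matrix of `u(0, y)`. [cite: Rogawski1990, §1.10 p. 14] -/
theorem coe_heisMid (y : (AddMonoidHom.id K + σ.toAddMonoidHom).ker) :
    (((heisMid σ y : unitaryGroupOfForm σ ((StdForm.antidiagonal 3).over K)) : GL (Fin 3) K) : Matrix (Fin 3) (Fin 3) K) =
      Matrix.transvection 0 2 (y : K) := rfl

omit [Valued K ℤᵐ⁰] in
/-- The matrix of `u(0, y)⁻¹ = u(0, -y)`. [cite: Rogawski1990, §1.10 p. 14] -/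
theorem coe_heisMid_inv (y : (AddMonoidHom.id K + σ.toAddMonoidHom).ker) :
    ((((heisMid σ y)⁻¹ : unitaryGroupOfForm σ ((StdForm.antidiagonal 3).over K)) : GL (Fin 3) K) : Matrix (Fin 3) (Fin 3) K) =
      Matrix.transvection 0 2 (-(y : K)) := rfl

omit [Valued K ℤᵐ⁰] in
/-- `u(0, y)` is upper unitriangular. [cite: Rogawski1990, §1.10 p. 14] -/
theorem coe_heisMid_mem_upperUnitriangular (y : (AddMonoidHom.id K + σ.toAddMonoidHom).ker) :
    ((heisMid σ y : unitaryGroupOfForm σ ((StdForm.antidiagonal 3).over K)) : GL (Fin 3) K) ∈ upperUnitriangular (Fin 3) K := by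
  rw [mem_upperUnitriangular_iff]
  refine ⟨fun i j hij => ?_, fun i => ?_⟩
  · change (j : Fin 3) < i at hij
    rw [coe_heisMid, transvection_zero_two_apply]
    fin_cases i <;> fin_cases j <;> simp_all
  · rw [coe_heisMid, transvection_zero_two_apply]; fin_cases i <;> simp

omit [Valued K ℤᵐ⁰] in
/-- `u(0, y)⁻¹ u(0, y') = u(0, y' - y)`. [cite: Rogawski1990, §1.10 p. 14] -/
theorem heisMid_inv_mul (y y' : (AddMonoidHom.id K + σ.toAddMonoidHom).ker) : (heisMid σ y)⁻¹ * heisMid σ y' = heisMid σ (y' - y) := by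
  refine Subtype.ext (Units.ext ?_)
  rw [Subgroup.coe_mul, Units.val_mul, coe_heisMid_inv, coe_heisMid, coe_heisMid,
    Matrix.transvection_mul_transvection_same (0 : Fin 3) 2 (by decide), AddSubgroupClass.coe_sub, neg_add_eq_sub]

/-- **`u(0, y) ∈ K_P ↔ v(y) ≤ 1`.** [cite: Rogawski1990, §1.10 p. 14] [cite: CartierCorvallis1979, §IV (4.2)] -/
theorem heisMid_mem_borelInt_iff (hd : UnramifiedLocalConjDatum σ ϖ) (y : (AddMonoidHom.id K + σ.toAddMonoidHom).ker) :
    heisMid σ y ∈ hd.borelLatticeU ⊓ unitaryInt σ ((StdForm.antidiagonal 3).over K) ↔ Valued.v (y : K) ≤ 1 := by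
  rw [hd.mem_borelInt_iff_three, coe_heisMid, transvection_zero_two_apply, transvection_zero_two_apply]
  simp only [coe_heisMid_mem_upperUnitriangular, true_and]
  simp

/-- **Two level-zero neighbours `u(0,y) K₀ = u(0,y') K₀` iff `y' - y ∈ 𝒪`.** [cite: BruhatTits1972, (4.4.4)] -/
theorem heisMid_coe_eq_iff (hd : UnramifiedLocalConjDatum σ ϖ) (y y' : (AddMonoidHom.id K + σ.toAddMonoidHom).ker) :
    ((heisMid σ y : unitaryGroupOfForm σ ((StdForm.antidiagonal 3).over K)) :
        unitaryGroupOfForm σ ((StdForm.antidiagonal 3).over K) ⧸ unitaryInt σ ((StdForm.antidiagonal 3).over K)) = ↑(heisMid σ y') ↔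
      Valued.v ((y' : K) - y) ≤ 1 := by
  rw [QuotientGroup.eq, heisMid_inv_mul, ← AddSubgroupClass.coe_sub, ← hd.heisMid_mem_borelInt_iff, hd.mem_borelLatticeU_inf_unitaryInt_iff]
  simp only [coe_heisMid_mem_upperUnitriangular, true_and]

/-- **`t u(0, y) t⁻¹ = u(0, ϖ² y) ∈ K_P` when `v(y) ≤ v(ϖ⁻²)`**, in particular for the level-zero neighbours (`v(y) = v(ϖ⁻¹)`).
[cite: BruhatTits1972, (4.4.4)] -/
theorem conj_torusGen_heisMid_mem_borelInt (hd : UnramifiedLocalConjDatum σ ϖ) {y : (AddMonoidHom.id K + σ.toAddMonoidHom).ker}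
    (hy : Valued.v (y : K) ≤ WithZero.exp (2 : ℤ)) :
    hd.torusGen * heisMid σ y * hd.torusGen⁻¹ ∈ hd.borelLatticeU ⊓ unitaryInt σ ((StdForm.antidiagonal 3).over K) := by
  rw [hd.mem_borelInt_iff_three]
  refine ⟨?_, ?_, ?_⟩
  · have h := (coe_conj_mem_upperUnitriangular_iff (hϖ0 := uniformizer_ne_zero hd.vϖ) (-![1, 0, -1])
      ((heisMid σ y : unitaryGroupOfForm σ ((StdForm.antidiagonal 3).over K)) : GL (Fin 3) K)).2 (coe_heisMid_mem_upperUnitriangular y)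
    rwa [zpowDiagGL_neg, inv_inv, ← coe_torusGen, ← Subgroup.coe_inv, ← Subgroup.coe_mul, ← Subgroup.coe_mul] at h
  · rw [coe_conj_torusGen_apply, coe_heisMid, transvection_zero_two_apply]; simp
  · rw [coe_conj_torusGen_apply, coe_heisMid, transvection_zero_two_apply]
    simp only [Fin.isValue, Matrix.cons_val_zero, Matrix.cons_val_two, Matrix.tail_cons, Matrix.head_cons, sub_neg_eq_add,
      show (0 : Fin 3) = 2 ↔ False by decide, if_false, zero_add, and_self, if_true, map_mul, v_uniformizer_zpow hd.vϖ]
    calc WithZero.exp (-(1 + 1 : ℤ)) * Valued.v (y : K) ≤ WithZero.exp (-(1 + 1 : ℤ)) * WithZero.exp (2 : ℤ) := mul_le_mul_right hy _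
      _ = 1 := by rw [← WithZero.exp_add]; norm_num

/-! ## §6 EXHAUSTION: every coset of `K₀ t K₀ ∕ K₀` is `u t K₀` (`u ∈ K_P`), `u(0, y) K₀` (`v(y) = v(ϖ⁻¹)`) or `t⁻¹ K₀` -/

/-- Valuation bookkeeping: `v(x ϖ^c) ≤ exp d ⇒ v(x) ≤ exp (d + c)`. [cite: Serre1979, Ch. I §1] -/
theorem v_le_exp_of_mul_zpow_le (hd : UnramifiedLocalConjDatum σ ϖ) {x : K} {c d : ℤ} (h : Valued.v (x * ϖ ^ c) ≤ WithZero.exp d) :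
    Valued.v x ≤ WithZero.exp (d + c) := by
  have hϖ0 := uniformizer_ne_zero hd.vϖ
  have hx : x = x * ϖ ^ c * ϖ ^ (-c) := by rw [mul_assoc, ← zpow_add₀ hϖ0, add_neg_cancel, zpow_zero, mul_one]
  rw [hx, map_mul, v_uniformizer_zpow hd.vϖ, neg_neg, WithZero.exp_add]
  exact mul_le_mul_left h _

/-- Discreteness: `1 < v(x) ≤ exp 1 ⇒ v(x) = exp 1`. [cite: Serre1979, Ch. I §1] -/
theorem v_eq_exp_one_of_one_lt {x : K} (h1 : 1 < Valued.v x) (h2 : Valued.v x ≤ WithZero.exp (1 : ℤ)) :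
    Valued.v x = WithZero.exp (1 : ℤ) := by
  have hx0 : x ≠ 0 := fun h => by rw [h, map_zero] at h1; exact not_lt_of_ge zero_le h1
  obtain ⟨e, he⟩ := exists_v_eq_exp hx0
  rw [he] at h1 h2 ⊢
  rw [← WithZero.exp_zero, WithZero.exp_lt_exp] at h1
  rw [WithZero.exp_le_exp] at h2
  congr 1; omega

/-- **EXHAUSTION OF `K₀ t K₀ ∕ K₀` BY THE THREE IWASAWA CELLS.**  Let `g ∈ K₀ t K₀`.  Write `g = u · diag(ϖ^a) · k` (Iwasawa, ★
`exists_eq_unipotent_mul_zpowDiagGL_mul_unitaryInt`; `a = (a₀, 0, -a₀)`).  All entries of `g k⁻¹ = u diag(ϖ^a)` have valuation `≤ v(ϖ⁻¹)` (§4),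
whence `a₀ ∈ {1, 0, -1}` (the diagonal entries `ϖ^{±a₀}`) and: (`a₀ = 1`) the entries `x = u₀₁` (read off `u₁₂ ϖ⁻¹ = -σ(x) ϖ⁻¹`) and
`z = u₀₂` (off `z ϖ⁻¹`) are integral, so `u ∈ K_P` and `g K₀ = u t K₀`; (`a₀ = 0`) `v(z), v(x) ≤ v(ϖ⁻¹)` and the unitarity relation
`z + σ z = -x σ x` forces `v(x) ≤ 1` (else `v(x σ x) = v(ϖ⁻²)`), `g ∉ K₀` forces `v(z) = v(ϖ⁻¹)`, and with an integral `τ`, `τ + σ τ = 1`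
((trace) of ★ `UnramifiedLocalConjDatum` — no `½`, every residue characteristic), `u(0, y)⁻¹ u ∈ K_P` for `y = z + x σ x τ ∈ K⁰` of valuation
`v(ϖ⁻¹)`, so `g K₀ = u(0, y) K₀`; (`a₀ = -1`) `v(x) ≤ v(ϖ⁻¹)`, `v(z) ≤ v(ϖ⁻²)`, so `t u t⁻¹ ∈ K_P` and `g K₀ = u t⁻¹ K₀ = t⁻¹ (t u t⁻¹) K₀ = t⁻¹ K₀`.
[cite: BruhatTits1972, (4.4.4)] [cite: Tits1979, §3.3.3] [cite: Rogawski1990, §1.10 p. 14] -/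
theorem exists_rep_of_mem_doubleCoset_torusGen (hd : UnramifiedLocalConjDatum σ ϖ)
    {g : unitaryGroupOfForm σ ((StdForm.antidiagonal 3).over K)}
    (hg : g ∈ DoubleCoset.doubleCoset hd.torusGen (unitaryInt σ ((StdForm.antidiagonal 3).over K) : Set _)
      (unitaryInt σ ((StdForm.antidiagonal 3).over K))) :
    (∃ u ∈ hd.borelLatticeU ⊓ unitaryInt σ ((StdForm.antidiagonal 3).over K),
        (g : unitaryGroupOfForm σ ((StdForm.antidiagonal 3).over K) ⧸ unitaryInt σ ((StdForm.antidiagonal 3).over K)) = ↑(u * hd.torusGen)) ∨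
    (∃ y : (AddMonoidHom.id K + σ.toAddMonoidHom).ker, Valued.v (y : K) = WithZero.exp (1 : ℤ) ∧
        (g : unitaryGroupOfForm σ ((StdForm.antidiagonal 3).over K) ⧸ unitaryInt σ ((StdForm.antidiagonal 3).over K)) = ↑(heisMid σ y)) ∨
    (g : unitaryGroupOfForm σ ((StdForm.antidiagonal 3).over K) ⧸ unitaryInt σ ((StdForm.antidiagonal 3).over K)) = ↑(hd.torusGen⁻¹) := by
  have hϖ0 := uniformizer_ne_zero hd.vϖ
  obtain ⟨u, d, k, a, hu, ha, hdcoe, hk, hgeq⟩ := hd.exists_eq_unipotent_mul_zpowDiagGL_mul_unitaryInt g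
  have a1 : a 1 = 0 := by have h := ha 1; rw [show Fin.rev (1 : Fin 3) = 1 from by decide] at h; omega
  have a2 : a 2 = -a 0 := by have h := ha 0; rwa [show Fin.rev (0 : Fin 3) = 2 from by decide] at h
  -- `g K₀ = u d K₀` and `u d ∈ K₀ t K₀`
  have hcoset : (g : unitaryGroupOfForm σ ((StdForm.antidiagonal 3).over K) ⧸ unitaryInt σ ((StdForm.antidiagonal 3).over K)) = ↑(u * d) := by
    rw [QuotientGroup.eq, hgeq]
    simpa [mul_assoc] using (unitaryInt σ ((StdForm.antidiagonal 3).over K)).inv_mem hk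
  have hud : u * d ∈ DoubleCoset.doubleCoset hd.torusGen (unitaryInt σ ((StdForm.antidiagonal 3).over K) : Set _)
      (unitaryInt σ ((StdForm.antidiagonal 3).over K)) := by
    have h := hd.mul_inv_mem_doubleCoset_torusGen hg hk
    rwa [hgeq, mul_assoc (u * d), mul_inv_cancel, mul_one] at h
  -- entries of `u d`
  have hent : ∀ i j, Valued.v (((u : GL (Fin 3) K) : Matrix (Fin 3) (Fin 3) K) i j * ϖ ^ a j) ≤ WithZero.exp (1 : ℤ) := by
    intro i j
    have h := hd.v_apply_le_exp_one_of_mem_doubleCoset_torusGen hud i j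
    rwa [Subgroup.coe_mul, Units.val_mul, hdcoe, coe_zpowDiagGL, Matrix.mul_diagonal] at h
  have hT := blockTriangular_of_mem_upperUnitriangular hu
  have hdiag := apply_self_of_mem_upperUnitriangular hu
  -- `-1 ≤ a₀ ≤ 1`
  have h00 : -a 0 ≤ 1 := by
    have h := hent 0 0
    rwa [hdiag, one_mul, v_uniformizer_zpow hd.vϖ, WithZero.exp_le_exp] at h
  have h22 : a 0 ≤ 1 := by
    have h := hent 2 2
    rwa [hdiag, one_mul, v_uniformizer_zpow hd.vϖ, a2, neg_neg, WithZero.exp_le_exp] at h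
  -- the coordinates `x = u₀₁`, `z = u₀₂`; `u₁₂ = -σ x`; `z + σ z + x σ x = 0`
  have h12 := apply_one_two_eq_three hu
  have hrel := apply_add_map_apply_eq_three hd.σσ hu
  rcases (show a 0 = 1 ∨ a 0 = 0 ∨ a 0 = -1 by omega) with h1 | h0 | hm1
  · -- TOP CELL
    left
    have ha' : a = ![1, 0, -1] := by
      funext i; fin_cases i
      · exact h1
      · exact a1
      · simp [a2, h1]
    have hdt : d = hd.torusGen := Subtype.ext (by rw [hdcoe, ha', coe_torusGen])
    refine ⟨u, ?_, by rw [hcoset, hdt]⟩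
    rw [hd.mem_borelInt_iff_three]
    refine ⟨hu, ?_, ?_⟩
    · -- from `v(u₁₂ ϖ^{a₂}) ≤ exp 1`, `u₁₂ = -σ x`, `a₂ = -1`
      have h := hent 1 2
      rw [h12, a2, h1, neg_mul, Valuation.map_neg] at h
      have h' := hd.v_le_exp_of_mul_zpow_le h
      rwa [hd.vσ, show (1 : ℤ) + -1 = 0 by norm_num, WithZero.exp_zero] at h'
    · have h := hent 0 2
      rw [a2, h1] at h
      have h' := hd.v_le_exp_of_mul_zpow_le h
      rwa [show (1 : ℤ) + -1 = 0 by norm_num, WithZero.exp_zero] at h'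
  · -- MIDDLE CELL
    right; left
    have ha' : a = 0 := by
      funext i; fin_cases i
      · exact h0
      · exact a1
      · simp [a2, h0]
    have hd1 : d = 1 := Subtype.ext (by rw [hdcoe, ha', zpowDiagGL_zero]; rfl)
    have hx1 : Valued.v (((u : GL (Fin 3) K) : Matrix (Fin 3) (Fin 3) K) 0 1) ≤ WithZero.exp (1 : ℤ) := by
      have h := hent 0 1; rwa [a1, zpow_zero, mul_one] at h
    have hz1 : Valued.v (((u : GL (Fin 3) K) : Matrix (Fin 3) (Fin 3) K) 0 2) ≤ WithZero.exp (1 : ℤ) := by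
      have h := hent 0 2; rwa [a2, h0, neg_zero, zpow_zero, mul_one] at h
    -- `v x ≤ 1`
    have hx : Valued.v (((u : GL (Fin 3) K) : Matrix (Fin 3) (Fin 3) K) 0 1) ≤ 1 := by
      by_contra hx
      have hxe := v_eq_exp_one_of_one_lt (lt_of_not_ge hx) hx1
      have hzz : Valued.v (((u : GL (Fin 3) K) : Matrix (Fin 3) (Fin 3) K) 0 2 + σ (((u : GL (Fin 3) K) : Matrix (Fin 3) (Fin 3) K) 0 2)) ≤
          WithZero.exp (1 : ℤ) :=
        (Valuation.map_add _ _ _).trans (max_le hz1 (by rw [hd.vσ]; exact hz1))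
      have heq : ((u : GL (Fin 3) K) : Matrix (Fin 3) (Fin 3) K) 0 2 + σ (((u : GL (Fin 3) K) : Matrix (Fin 3) (Fin 3) K) 0 2) =
          -(((u : GL (Fin 3) K) : Matrix (Fin 3) (Fin 3) K) 0 1 * σ (((u : GL (Fin 3) K) : Matrix (Fin 3) (Fin 3) K) 0 1)) := by
        linear_combination hrel
      rw [heq, Valuation.map_neg, map_mul, hd.vσ, hxe, ← WithZero.exp_add, WithZero.exp_le_exp] at hzz
      norm_num at hzz
    -- `v z = exp 1` (otherwise `u ∈ K_P ≤ K₀` and `g ∈ K₀ ∩ K₀ t K₀ = ∅`)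
    have hz : Valued.v (((u : GL (Fin 3) K) : Matrix (Fin 3) (Fin 3) K) 0 2) = WithZero.exp (1 : ℤ) := by
      refine v_eq_exp_one_of_one_lt (lt_of_not_ge fun hz => ?_) hz1
      have huK : u ∈ unitaryInt σ ((StdForm.antidiagonal 3).over K) :=
        (Subgroup.mem_inf.1 ((hd.mem_borelInt_iff_three).2 ⟨hu, hx, hz⟩)).2
      have hgK : g ∈ unitaryInt σ ((StdForm.antidiagonal 3).over K) := by
        rw [hgeq, hd1, mul_one]; exact (unitaryInt σ _).mul_mem huK hk
      have hg0 : g ∈ DoubleCoset.doubleCoset (hd.torusGen ^ 0) (unitaryInt σ ((StdForm.antidiagonal 3).over K) : Set _)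
          (unitaryInt σ ((StdForm.antidiagonal 3).over K)) :=
        DoubleCoset.mem_doubleCoset.2 ⟨g, hgK, 1, (unitaryInt σ _).one_mem, by rw [pow_zero, mul_one, mul_one]⟩
      have hg1 : g ∈ DoubleCoset.doubleCoset (hd.torusGen ^ 1) (unitaryInt σ ((StdForm.antidiagonal 3).over K) : Set _)
          (unitaryInt σ ((StdForm.antidiagonal 3).over K)) := by rwa [pow_one]
      exact Set.disjoint_left.1 (hd.disjoint_doubleCoset_torusGen_pow (show (0 : ℕ) ≠ 1 by decide)) hg0 hg1
    -- the trace-one element and `y = z + x σ x τ`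
    obtain ⟨τ, hτv, hτ⟩ := hd.trace
    set x := ((u : GL (Fin 3) K) : Matrix (Fin 3) (Fin 3) K) 0 1 with hx_def
    set z := ((u : GL (Fin 3) K) : Matrix (Fin 3) (Fin 3) K) 0 2 with hz_def
    have hy0 : z + x * σ x * τ + σ (z + x * σ x * τ) = 0 := by
      rw [map_add, map_mul, map_mul, hd.σσ]
      linear_combination hrel + (x * σ x) * hτ
    have hw : Valued.v (x * σ x * τ) < Valued.v z := by
      rw [hz, map_mul, map_mul, hd.vσ]
      calc Valued.v x * Valued.v x * Valued.v τ ≤ 1 * 1 * 1 := mul_le_mul' (mul_le_mul' hx hx) hτv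
        _ < WithZero.exp (1 : ℤ) := by rw [one_mul, one_mul, ← WithZero.exp_zero, WithZero.exp_lt_exp]; norm_num
    have hyv : Valued.v (z + x * σ x * τ) = WithZero.exp (1 : ℤ) := by rw [Valuation.map_add_eq_of_lt_left _ hw, hz]
    refine ⟨⟨z + x * σ x * τ, (mem_ker_id_add_iff _).2 hy0⟩, hyv, ?_⟩
    rw [hcoset, hd1, mul_one, eq_comm, QuotientGroup.eq]
    -- `u(0, y)⁻¹ u ∈ K_P ≤ K₀`
    refine (Subgroup.mem_inf.1 ((hd.mem_borelInt_iff_three).2 ⟨?_, ?_, ?_⟩)).2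
    · rw [Subgroup.coe_mul]
      exact (upperUnitriangular (Fin 3) K).mul_mem ((upperUnitriangular (Fin 3) K).inv_mem (coe_heisMid_mem_upperUnitriangular _)) hu
    · rw [Subgroup.coe_mul, Units.val_mul, coe_heisMid_inv, Matrix.transvection_mul_apply_same, hT (show (1 : Fin 3) < 2 by decide),
        mul_zero, add_zero]
      exact hx
    · rw [Subgroup.coe_mul, Units.val_mul, coe_heisMid_inv, Matrix.transvection_mul_apply_same, hdiag, mul_one]
      change Valued.v (z + -(z + x * σ x * τ)) ≤ 1
      rw [show z + -(z + x * σ x * τ) = -(x * σ x * τ) by ring, Valuation.map_neg, map_mul, map_mul, hd.vσ]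
      calc Valued.v x * Valued.v x * Valued.v τ ≤ 1 * 1 * 1 := mul_le_mul' (mul_le_mul' hx hx) hτv
        _ = 1 := by rw [one_mul, one_mul]
  · -- BOTTOM CELL
    right; right
    have ha' : a = -![1, 0, -1] := by
      funext i; fin_cases i
      · exact hm1
      · simpa using a1
      · simp [a2, hm1]
    have hdt : d = hd.torusGen⁻¹ := Subtype.ext (by rw [hdcoe, ha', coe_torusGen_inv])
    have hx1 : Valued.v (((u : GL (Fin 3) K) : Matrix (Fin 3) (Fin 3) K) 0 1) ≤ WithZero.exp (1 : ℤ) := by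
      have h := hent 0 1; rwa [a1, zpow_zero, mul_one] at h
    have hz2 : Valued.v (((u : GL (Fin 3) K) : Matrix (Fin 3) (Fin 3) K) 0 2) ≤ WithZero.exp (2 : ℤ) := by
      have h := hent 0 2; rw [a2, hm1, neg_neg] at h
      have h' := hd.v_le_exp_of_mul_zpow_le h
      rwa [show (1 : ℤ) + 1 = 2 by norm_num] at h'
    -- `t u t⁻¹ ∈ K_P`
    have hw : hd.torusGen * u * hd.torusGen⁻¹ ∈ hd.borelLatticeU ⊓ unitaryInt σ ((StdForm.antidiagonal 3).over K) := by
      rw [hd.mem_borelInt_iff_three]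
      refine ⟨?_, ?_, ?_⟩
      · have h := (coe_conj_mem_upperUnitriangular_iff (hϖ0 := hϖ0) (-![1, 0, -1]) (u : GL (Fin 3) K)).2 hu
        rwa [zpowDiagGL_neg, inv_inv, ← coe_torusGen, ← Subgroup.coe_inv, ← Subgroup.coe_mul, ← Subgroup.coe_mul] at h
      · rw [coe_conj_torusGen_apply, map_mul, v_uniformizer_zpow hd.vϖ]
        simp only [Fin.isValue, Matrix.cons_val_zero, Matrix.cons_val_one, sub_zero]
        calc WithZero.exp (-1 : ℤ) * Valued.v (((u : GL (Fin 3) K) : Matrix (Fin 3) (Fin 3) K) 0 1)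
            ≤ WithZero.exp (-1 : ℤ) * WithZero.exp (1 : ℤ) := mul_le_mul_right hx1 _
          _ = 1 := by rw [← WithZero.exp_add]; norm_num
      · rw [coe_conj_torusGen_apply, map_mul, v_uniformizer_zpow hd.vϖ]
        simp only [Fin.isValue, Matrix.cons_val_zero, Matrix.cons_val_two, Matrix.tail_cons, Matrix.head_cons, sub_neg_eq_add]
        calc WithZero.exp (-(1 + 1) : ℤ) * Valued.v (((u : GL (Fin 3) K) : Matrix (Fin 3) (Fin 3) K) 0 2)
            ≤ WithZero.exp (-(1 + 1) : ℤ) * WithZero.exp (2 : ℤ) := mul_le_mul_right hz2 _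
          _ = 1 := by rw [← WithZero.exp_add]; norm_num
    rw [hcoset, hdt, eq_comm, QuotientGroup.eq]
    have h : (hd.torusGen⁻¹)⁻¹ * (u * hd.torusGen⁻¹) = hd.torusGen * u * hd.torusGen⁻¹ := by group
    rw [h]
    exact (Subgroup.mem_inf.1 hw).2

/-! ## §7 The three cells: Iwasawa exponents, coset criteria, shell membership -/

/-- **Top neighbours**: `u t K₀ = u' t K₀` (`u, u' ∈ K_P`) iff `u⁻¹ u' ∈ t K_P t⁻¹`. [cite: BruhatTits1972, (4.4.4)] -/
theorem mul_torusGen_coe_eq_iff (hd : UnramifiedLocalConjDatum σ ϖ) {u u' : unitaryGroupOfForm σ ((StdForm.antidiagonal 3).over K)}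
    (hu : u ∈ hd.borelLatticeU ⊓ unitaryInt σ ((StdForm.antidiagonal 3).over K))
    (hu' : u' ∈ hd.borelLatticeU ⊓ unitaryInt σ ((StdForm.antidiagonal 3).over K)) :
    ((u * hd.torusGen : unitaryGroupOfForm σ ((StdForm.antidiagonal 3).over K)) :
        unitaryGroupOfForm σ ((StdForm.antidiagonal 3).over K) ⧸ unitaryInt σ ((StdForm.antidiagonal 3).over K)) = ↑(u' * hd.torusGen) ↔
      u⁻¹ * u' ∈ toConjAct hd.torusGen • (hd.borelLatticeU ⊓ unitaryInt σ ((StdForm.antidiagonal 3).over K)) := by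
  have hw : u⁻¹ * u' ∈ hd.borelLatticeU ⊓ unitaryInt σ ((StdForm.antidiagonal 3).over K) := Subgroup.mul_mem _ (Subgroup.inv_mem _ hu) hu'
  have hwU : ((u⁻¹ * u' : unitaryGroupOfForm σ ((StdForm.antidiagonal 3).over K)) : GL (Fin 3) K) ∈ upperUnitriangular (Fin 3) K :=
    ((hd.mem_borelLatticeU_inf_unitaryInt_iff).1 hw).1
  have hconj : hd.torusGen⁻¹ * (u⁻¹ * u') * hd.torusGen ∈ hd.borelLatticeU ⊓ unitaryInt σ ((StdForm.antidiagonal 3).over K) ↔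
      hd.torusGen⁻¹ * (u⁻¹ * u') * hd.torusGen ∈ unitaryInt σ ((StdForm.antidiagonal 3).over K) := by
    rw [hd.mem_borelLatticeU_inf_unitaryInt_iff, and_iff_right_iff_imp]
    intro _
    rw [Subgroup.coe_mul, Subgroup.coe_mul, Subgroup.coe_inv, coe_torusGen]
    exact (coe_conj_mem_upperUnitriangular_iff _ _).2 hwU
  rw [QuotientGroup.eq, Subgroup.mem_pointwise_smul_iff_inv_smul_mem, ← toConjAct_inv, toConjAct_smul, inv_inv, hconj,
    show (u * hd.torusGen)⁻¹ * (u' * hd.torusGen) = hd.torusGen⁻¹ * (u⁻¹ * u') * hd.torusGen by group]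

/-- The Iwasawa exponents of a top neighbour: `a(u t) = (1, 0, -1)` (`u ∈ K_P`). [cite: BruhatTits1972, (4.4.3)] -/
theorem iwasawaExp_mul_torusGen (hd : UnramifiedLocalConjDatum σ ϖ) {u : unitaryGroupOfForm σ ((StdForm.antidiagonal 3).over K)}
    (hu : u ∈ hd.borelLatticeU ⊓ unitaryInt σ ((StdForm.antidiagonal 3).over K)) : hd.iwasawaExp (u * hd.torusGen) = ![1, 0, -1] :=
  hd.iwasawaExp_eq (k := 1) ((hd.mem_borelLatticeU_inf_unitaryInt_iff).1 hu).1 (coe_torusGen hd) (Subgroup.one_mem _) (by rw [mul_one])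

/-- The Iwasawa exponents of a level-zero neighbour: `a(u(0, y)) = 0`. [cite: BruhatTits1972, (4.4.3)] -/
theorem iwasawaExp_heisMid (hd : UnramifiedLocalConjDatum σ ϖ) (y : (AddMonoidHom.id K + σ.toAddMonoidHom).ker) :
    hd.iwasawaExp (heisMid σ y) = 0 :=
  hd.iwasawaExp_eq (t := 1) (k := 1) (coe_heisMid_mem_upperUnitriangular y) (by rw [OneMemClass.coe_one, zpowDiagGL_zero])
    (Subgroup.one_mem _) (by rw [mul_one, mul_one])

/-- The Iwasawa exponents of the bottom neighbour: `a(t⁻¹) = (-1, 0, 1)`. [cite: BruhatTits1972, (4.4.3)] -/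
theorem iwasawaExp_torusGen_inv (hd : UnramifiedLocalConjDatum σ ϖ) : hd.iwasawaExp hd.torusGen⁻¹ = -![1, 0, -1] :=
  hd.iwasawaExp_eq (u := 1) (k := 1) (by rw [OneMemClass.coe_one]; exact Subgroup.one_mem _) (coe_torusGen_inv hd)
    (Subgroup.one_mem _) (by rw [one_mul, mul_one])

/-- Entry bound transported through a double coset: if all entries of `g` have valuation `≤ C`, so do those of every `g' ∈ K₀ g K₀`.
[cite: BruhatTits1972, (4.4.3)] -/
theorem v_apply_le_of_mem_doubleCoset {g g' : unitaryGroupOfForm σ ((StdForm.antidiagonal 3).over K)} {C : ℤᵐ⁰}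
    (hg' : g' ∈ DoubleCoset.doubleCoset g (unitaryInt σ ((StdForm.antidiagonal 3).over K) : Set _) (unitaryInt σ ((StdForm.antidiagonal 3).over K)))
    (hC : ∀ i j, Valued.v (((g : GL (Fin 3) K) : Matrix (Fin 3) (Fin 3) K) i j) ≤ C) (i j : Fin 3) :
    Valued.v (((g' : GL (Fin 3) K) : Matrix (Fin 3) (Fin 3) K) i j) ≤ C := by
  obtain ⟨k₁, hk₁, k₂, hk₂, rfl⟩ := DoubleCoset.mem_doubleCoset.1 hg'
  have h1 := (mem_unitaryInt_iff.1 (hk₁ : k₁ ∈ unitaryInt σ _)).1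
  have h2 := (mem_unitaryInt_iff.1 (hk₂ : k₂ ∈ unitaryInt σ _)).1
  rw [Subgroup.coe_mul, Subgroup.coe_mul, Units.val_mul, Units.val_mul, Matrix.mul_apply]
  refine Valuation.map_sum_le _ fun l _ => ?_
  rw [Matrix.mul_apply, Finset.sum_mul]
  refine Valuation.map_sum_le _ fun m _ => ?_
  rw [map_mul, map_mul]
  calc Valued.v (((k₁ : GL (Fin 3) K) : Matrix (Fin 3) (Fin 3) K) i m) * Valued.v (((g : GL (Fin 3) K) : Matrix (Fin 3) (Fin 3) K) m l) *
        Valued.v (((k₂ : GL (Fin 3) K) : Matrix (Fin 3) (Fin 3) K) l j)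
      ≤ 1 * C * 1 := mul_le_mul' (mul_le_mul' (h1 i m) (hC m l)) (h2 l j)
    _ = C := by rw [one_mul, mul_one]

/-- **A level-zero neighbour lies on the shell `K₀ t K₀`**: for `v(y) = v(ϖ⁻¹)`, `u(0, y) ∈ K₀ t K₀` (its Cartan exponent `(a₀, 0, -a₀)`, `a₀ ≥ 0`, has
`v(ϖ^{-a₀}) ≤ v(y) = exp 1` by the transported entry bound, and `a₀ ≠ 0` since `u(0, y) ∉ K₀`). [cite: BruhatTits1972, (4.4.3), (4.4.4)] -/
theorem heisMid_mem_doubleCoset_torusGen (hd : UnramifiedLocalConjDatum σ ϖ) {y : (AddMonoidHom.id K + σ.toAddMonoidHom).ker}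
    (hy : Valued.v (y : K) = WithZero.exp (1 : ℤ)) :
    heisMid σ y ∈ DoubleCoset.doubleCoset hd.torusGen (unitaryInt σ ((StdForm.antidiagonal 3).over K) : Set _)
      (unitaryInt σ ((StdForm.antidiagonal 3).over K)) := by
  obtain ⟨a, ha, h⟩ := heckeCosetMk_zpowDiagGL_eq_of_unitary hd (heisMid σ y)
  obtain ⟨A, hA, B, hB, hAB⟩ := (heckeAlgebra.heckeCosetMk_eq_iff (unitaryInt σ ((StdForm.antidiagonal 3).over K))
    (Submonoid.mem_top _) (Submonoid.mem_top _)).1 h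
  have a1 : a 1 = 0 := by have h := ha.2 1; rw [show Fin.rev (1 : Fin 3) = 1 from by decide] at h; omega
  have a2 : a 2 = -a 0 := by have h := ha.2 0; rwa [show Fin.rev (0 : Fin 3) = 2 from by decide] at h
  have ha0 : 0 ≤ a 0 := by have h := ha.1 (show (0 : Fin 3) ≤ 1 by decide); omega
  -- the torus representative lies in `K₀ u(0,y) K₀`, so its entries are bounded by `exp 1`
  have hmem : (⟨zpowDiagGL (uniformizer_ne_zero hd.vϖ) a, zpowDiagGL_mem_unitaryGroupOfForm hd.σϖ _ ha.2⟩ :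
      unitaryGroupOfForm σ ((StdForm.antidiagonal 3).over K)) ∈
      DoubleCoset.doubleCoset (heisMid σ y) (unitaryInt σ ((StdForm.antidiagonal 3).over K) : Set _) (unitaryInt σ ((StdForm.antidiagonal 3).over K)) :=
    DoubleCoset.mem_doubleCoset.2 ⟨A⁻¹, (unitaryInt σ _).inv_mem hA, B⁻¹, (unitaryInt σ _).inv_mem hB, by rw [hAB]; group⟩
  have hC : ∀ i j, Valued.v ((((heisMid σ y : unitaryGroupOfForm σ ((StdForm.antidiagonal 3).over K)) : GL (Fin 3) K) :
      Matrix (Fin 3) (Fin 3) K) i j) ≤ WithZero.exp (1 : ℤ) := by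
    intro i j
    rw [coe_heisMid, transvection_zero_two_apply]
    have h1 : (1 : ℤᵐ⁰) ≤ WithZero.exp (1 : ℤ) := by rw [← WithZero.exp_zero, WithZero.exp_le_exp]; norm_num
    fin_cases i <;> fin_cases j <;> simp [hy, h1]
  have h22 := v_apply_le_of_mem_doubleCoset hmem hC 2 2
  change Valued.v (((zpowDiagGL (uniformizer_ne_zero hd.vϖ) a : GL (Fin 3) K) : Matrix (Fin 3) (Fin 3) K) 2 2) ≤ _ at h22
  rw [coe_zpowDiagGL, Matrix.diagonal_apply_eq, v_uniformizer_zpow hd.vϖ, a2, neg_neg, WithZero.exp_le_exp] at h22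
  -- `a₀ ≠ 0`: otherwise `u(0, y) ∈ K₀`
  have ha0' : a 0 ≠ 0 := by
    intro h0
    have haz : a = 0 := by
      funext i; fin_cases i
      · exact h0
      · exact a1
      · simp [a2, h0]
    have hK : heisMid σ y ∈ unitaryInt σ ((StdForm.antidiagonal 3).over K) := by
      rw [hAB]
      refine (unitaryInt σ _).mul_mem ((unitaryInt σ _).mul_mem hA ?_) hB
      have h1 : (⟨zpowDiagGL (uniformizer_ne_zero hd.vϖ) a, zpowDiagGL_mem_unitaryGroupOfForm hd.σϖ _ ha.2⟩ :
          unitaryGroupOfForm σ ((StdForm.antidiagonal 3).over K)) = 1 :=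
        Subtype.ext (show zpowDiagGL (uniformizer_ne_zero hd.vϖ) a = ((1 : unitaryGroupOfForm σ ((StdForm.antidiagonal 3).over K)) : GL (Fin 3) K) by
          rw [haz, zpowDiagGL_zero, OneMemClass.coe_one])
      rw [h1]; exact Subgroup.one_mem _
    have hv := (mem_unitaryInt_iff.1 hK).1 0 2
    rw [coe_heisMid, transvection_zero_two_apply] at hv
    simp only [Fin.isValue, show (0 : Fin 3) = 2 ↔ False by decide, if_false, and_self, if_true, zero_add, hy,
      ← WithZero.exp_zero, WithZero.exp_le_exp] at hv
    norm_num at hv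
  have ha' : a = ![1, 0, -1] := by
    have h1 : a 0 = 1 := by omega
    funext i; fin_cases i
    · exact h1
    · exact a1
    · simp [a2, h1]
  have ht : (⟨zpowDiagGL (uniformizer_ne_zero hd.vϖ) a, zpowDiagGL_mem_unitaryGroupOfForm hd.σϖ _ ha.2⟩ :
      unitaryGroupOfForm σ ((StdForm.antidiagonal 3).over K)) = hd.torusGen :=
    Subtype.ext (show zpowDiagGL (uniformizer_ne_zero hd.vϖ) a = (hd.torusGen : GL (Fin 3) K) by rw [ha', coe_torusGen])
  rw [hAB, ht]
  exact DoubleCoset.mem_doubleCoset.2 ⟨A, hA, B, hB, rfl⟩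

/-! ## §8 THE CONTRACTING TRANSVERSAL of `K₀ t K₀ ∕ K₀` -/

/-- **THE HYPERSPECIAL HECKE NEIGHBOURS OF `U(3)`** — for any transversal `R₊ ⊆ K_P` of `K_P ∕ t K_P t⁻¹` and any transversal `R₀ ⊆ K⁰` of the
classes of valuation exactly `v(ϖ⁻¹)` in `ϖ⁻¹𝒪⁰ ∕ 𝒪⁰` (`K⁰ = ker(id + σ)`), the finite set `X = R₊·t ∪ u(0, R₀) ∪ {t⁻¹}` maps BIJECTIVELY onto
`K₀ t K₀ ∕ K₀` — the hypothesis `hX` of ★ `SphericalCoefficient.not_isSquareIntegrableModCenter_of_isSpherical_of_contracting` for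
`(G, K, K_N, t) = (U(σ,J₀)(K), K₀, K_P, diag(ϖ,1,ϖ⁻¹))`. [cite: BruhatTits1972, (4.4.4)] [cite: Tits1979, §3.3.3] [cite: SerreTrees1980, II.1.1] -/
theorem bijOn_heckeNeighbours [DecidableEq K] (hd : UnramifiedLocalConjDatum σ ϖ)
    {Rp : Finset (unitaryGroupOfForm σ ((StdForm.antidiagonal 3).over K))}
    (hRp : ∀ u ∈ Rp, u ∈ hd.borelLatticeU ⊓ unitaryInt σ ((StdForm.antidiagonal 3).over K))
    (hRp_inj : ∀ u ∈ Rp, ∀ u' ∈ Rp, u⁻¹ * u' ∈ toConjAct hd.torusGen • (hd.borelLatticeU ⊓ unitaryInt σ ((StdForm.antidiagonal 3).over K)) → u = u')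
    (hRp_surj : ∀ u ∈ hd.borelLatticeU ⊓ unitaryInt σ ((StdForm.antidiagonal 3).over K),
      ∃ r ∈ Rp, r⁻¹ * u ∈ toConjAct hd.torusGen • (hd.borelLatticeU ⊓ unitaryInt σ ((StdForm.antidiagonal 3).over K)))
    {R0 : Finset (AddMonoidHom.id K + σ.toAddMonoidHom).ker} (hR0 : ∀ y ∈ R0, Valued.v (y : K) = WithZero.exp (1 : ℤ))
    (hR0_inj : ∀ y ∈ R0, ∀ y' ∈ R0, Valued.v ((y' : K) - y) ≤ 1 → y = y')
    (hR0_surj : ∀ y : (AddMonoidHom.id K + σ.toAddMonoidHom).ker, Valued.v (y : K) = WithZero.exp (1 : ℤ) →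
      ∃ r ∈ R0, Valued.v ((y : K) - r) ≤ 1) :
    Set.BijOn (fun x : unitaryGroupOfForm σ ((StdForm.antidiagonal 3).over K) =>
        (x : unitaryGroupOfForm σ ((StdForm.antidiagonal 3).over K) ⧸ unitaryInt σ ((StdForm.antidiagonal 3).over K)))
      (Rp.image (· * hd.torusGen) ∪ R0.image (heisMid σ) ∪ {hd.torusGen⁻¹} : Finset _)
      (orbit (unitaryInt σ ((StdForm.antidiagonal 3).over K))
        (hd.torusGen : unitaryGroupOfForm σ ((StdForm.antidiagonal 3).over K) ⧸ unitaryInt σ ((StdForm.antidiagonal 3).over K))) := by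
  set KP := hd.borelLatticeU ⊓ unitaryInt σ ((StdForm.antidiagonal 3).over K) with hKP
  -- orbit membership = shell membership
  have horb : ∀ g : unitaryGroupOfForm σ ((StdForm.antidiagonal 3).over K),
      (g : unitaryGroupOfForm σ ((StdForm.antidiagonal 3).over K) ⧸ unitaryInt σ ((StdForm.antidiagonal 3).over K)) ∈
        orbit (unitaryInt σ ((StdForm.antidiagonal 3).over K))
          (hd.torusGen : unitaryGroupOfForm σ ((StdForm.antidiagonal 3).over K) ⧸ unitaryInt σ ((StdForm.antidiagonal 3).over K)) ↔
      g ∈ DoubleCoset.doubleCoset hd.torusGen (unitaryInt σ ((StdForm.antidiagonal 3).over K) : Set _) (unitaryInt σ ((StdForm.antidiagonal 3).over K)) := by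
    intro g
    rw [heckeAlgebra.coe_mem_orbit_coe_iff, DoubleCoset.mem_doubleCoset]
    simp only [SetLike.mem_coe]
  -- membership in the three pieces
  have hmem : ∀ x, x ∈ (Rp.image (· * hd.torusGen) ∪ R0.image (heisMid σ) ∪ {hd.torusGen⁻¹} : Finset _) ↔
      (∃ u ∈ Rp, u * hd.torusGen = x) ∨ (∃ y ∈ R0, heisMid σ y = x) ∨ x = hd.torusGen⁻¹ := by
    intro x
    simp only [Finset.mem_union, Finset.mem_image, Finset.mem_singleton, or_assoc]
  refine ⟨fun x hx => ?_, fun x hx x' hx' hxx' => ?_, fun q hq => ?_⟩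
  · -- MapsTo
    rw [horb]
    rcases (hmem x).1 hx with ⟨u, hu, rfl⟩ | ⟨y, hy, rfl⟩ | rfl
    · exact DoubleCoset.mem_doubleCoset.2 ⟨u, (Subgroup.mem_inf.1 (hRp u hu)).2, 1, Subgroup.one_mem _, (mul_one _).symm⟩
    · exact hd.heisMid_mem_doubleCoset_torusGen (hR0 y hy)
    · exact hd.inv_torusGen_mem_doubleCoset
  · -- InjOn: equal cosets have equal Iwasawa exponents, hence the same cell; inside a cell the transversal hypotheses decide
    have hexp := hd.iwasawaExp_eq_of_coe_eq hxx'
    rcases (hmem x).1 hx with ⟨u, hu, rfl⟩ | ⟨y, hy, rfl⟩ | rfl <;>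
      rcases (hmem x').1 hx' with ⟨u', hu', rfl⟩ | ⟨y', hy', rfl⟩ | rfl
    · rw [hRp_inj u hu u' hu' ((hd.mul_torusGen_coe_eq_iff (hRp u hu) (hRp u' hu')).1 hxx')]
    · rw [hd.iwasawaExp_mul_torusGen (hRp u hu), hd.iwasawaExp_heisMid] at hexp
      exact absurd (congrFun hexp 0) (by simp)
    · rw [hd.iwasawaExp_mul_torusGen (hRp u hu), hd.iwasawaExp_torusGen_inv] at hexp
      exact absurd (congrFun hexp 0) (by simp)
    · rw [hd.iwasawaExp_mul_torusGen (hRp u' hu'), hd.iwasawaExp_heisMid] at hexp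
      exact absurd (congrFun hexp 0) (by simp)
    · rw [hR0_inj y hy y' hy' ((hd.heisMid_coe_eq_iff y y').1 hxx')]
    · rw [hd.iwasawaExp_heisMid, hd.iwasawaExp_torusGen_inv] at hexp
      exact absurd (congrFun hexp 0) (by simp)
    · rw [hd.iwasawaExp_mul_torusGen (hRp u' hu'), hd.iwasawaExp_torusGen_inv] at hexp
      exact absurd (congrFun hexp 0) (by simp)
    · rw [hd.iwasawaExp_heisMid, hd.iwasawaExp_torusGen_inv] at hexp
      exact absurd (congrFun hexp 0) (by simp)
    · rfl
  · -- SurjOn: exhaustion, then the transversal hypotheses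
    obtain ⟨g, rfl⟩ := QuotientGroup.mk_surjective q
    have hg := (horb g).1 hq
    rcases hd.exists_rep_of_mem_doubleCoset_torusGen hg with ⟨u, hu, hgu⟩ | ⟨y, hy, hgy⟩ | hgt
    · obtain ⟨r, hr, hru⟩ := hRp_surj u hu
      exact ⟨r * hd.torusGen, Finset.mem_coe.2 ((hmem _).2 (Or.inl ⟨r, hr, rfl⟩)),
        (((hd.mul_torusGen_coe_eq_iff (hRp r hr) hu).2 hru).trans hgu.symm)⟩
    · obtain ⟨r, hr, hry⟩ := hR0_surj y hy
      exact ⟨heisMid σ r, Finset.mem_coe.2 ((hmem _).2 (Or.inr (Or.inl ⟨r, hr, rfl⟩))),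
        (((hd.heisMid_coe_eq_iff r y).2 hry).trans hgy.symm)⟩
    · exact ⟨hd.torusGen⁻¹, Finset.mem_coe.2 ((hmem _).2 (Or.inr (Or.inr rfl))), hgt.symm⟩

end UnramifiedLocalConjDatum

end Literature.NumberTheory.Automorphic.HermitianLattice

end
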